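import Summits.AtomisticToContinuum.FouriersLaw.Theses.EmbeddedDrudeMourre
import Summits.AtomisticToContinuum.FouriersLaw.Theorems.EmbeddedDrudeMourreDrudeDissolutionStubPolynomialStationarity
import Summits.AtomisticToContinuum.FouriersLaw.Theorems.EmbeddedDrudeMourreDrudeDissolutionStubHarmonicPencilAlgebraGreen
import Literature.MathematicalPhysics.KineticTheory.HarmonicChaosDecomposition
import Literature.MathematicalPhysics.KineticTheory.InfiniteChainInvariantStates
import Literature.MathematicalPhysics.KineticTheory.InfiniteChainVariationalCalculus
import HarnessLib

/-!
# Stub KAlg `stub_harmonicPencilAlgebra`: the pencil's algebra at the harmonic point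
(line `gram-pencil-harmonic-chaos`, crux `EmbeddedDrudeMourre.DrudeDissolution`,
item stmt-AtomisticToContinuum-12593; `--supports` file proving the registered stub, closes nothing)

WHAT. With `𝒫 = Algebra.adjoin ℝ {σ ↦ q_x, σ ↦ p_x}` the algebra of local polynomial observables, the
Wick products `wick ω₂ T N f` of linear observables `φ(f) = Σ f^q_x q_x + Σ f^p_x p_x` (Janson's
recursion w.r.t. the thermal covariance `thermalCov ω₂ T`), the harmonic Liouville operator
`𝓛₀ = liouvilleZ (pinnedChain ω₂ 0 0 γ)` and the lattice Klein–Gordon generator on coefficient pairs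
`L f = (−(ω₂+2) f^p + S f^p + S⁻¹ f^p, f^q)` (inline:
`((-(ω₂ + 2)) • f.2 + mapDomain (· + 1) f.2 + mapDomain (· − 1) f.2, f.1)`), this file proves the
registered stub `stub_harmonicPencilAlgebra` = (a) ∧ (b) ∧ (c) ∧ (d):

* (a) `wick ω₂ T N f ∈ 𝒫` (`wick_mem_polyObs`), as is `linObs f`;
* (b) LEIBNIZ: `𝓛₀ :φ(f₀)⋯φ(f_{N−1}): = Σ_i :φ(f₀)⋯φ(L f_i)⋯φ(f_{N−1}):` pointwise
  (`liouvilleZ_wick_harmonic`, from the abstract `liouvilleZ_wick_of_linear`);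
* (c) `w_{Lf} = −iω w_f` and (d) `C_T(Lf, g) = −C_T(f, Lg)` — part 1 of this stub
  (`…StubHarmonicPencilAlgebraGreen`: `thermalWave_kg`, `thermalCov_kg_skew`, the Green identity).

Supporting calculus proved here: `liouvilleZ (pinnedChain ω₂ lam β γ)` is additive, `ℝ`-homogeneous,
commutes with finite sums and satisfies the Leibniz rule on `𝒫`
(`liouvilleZ_add/smul/sub/sum/mul_of_mem_polyObs`); the harmonic force is
`F_x = −(ω₂+2)q_x + q_{x+1} + q_{x−1}` and `𝓛₀ φ(f) = φ(L f)` (`liouvilleZ_linObs_harmonic`).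

HOW. (a) is the `wick` recursion and closure of a subalgebra. The derivation rules come from the landed
box calculus of stub S (`exists_rep_and_liouvilleZ_mem_of_mem_polyObs`: every element of `𝒫` is
`g ∘ boxRestrict R` with a `C¹` profile on every large centred box; `liouvilleZ_add/mul_comp_boxRestrict`).
`𝓛₀ φ(f) = φ(Lf)` is linearity plus Hamilton's equations `𝓛 q_x = p_x`, `𝓛 p_x = F_x`
(`liouvilleZ_position/momentum`) and the `Finsupp.sum` bookkeeping `sum_kgFst` of part 1. (b) is a
two-step induction along Janson's recursion
`W_{N+2}(f) = φ(f₀) W_{N+1}(tail f) − Σ_i C_T(f₀, f_{i+1}) W_N(tail f ∖ i)`: the derivation property and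
the induction hypotheses expand `𝓛₀ W_{N+2}(f)`, the recursion expands each `W_{N+2}(f[i ← L f_i])`
(`Fin.tail_update_zero/succ`, `Fin.removeNth_update(_succAbove)`, `Fin.sum_univ_succAbove`), and the two
expansions differ by `Σ_i (C_T(Lf₀, f_{i+1}) + C_T(f₀, Lf_{i+1})) W_N(…) = 0` by the skewness (d).
-/

noncomputable section

namespace Summit.AtomisticToContinuum.FouriersLaw.Theorems.DrudeDissolution.GramPencilHarmonicChaos

open MeasureTheory Filter Set Function Topology
open scoped InnerProductSpace ENNReal ComplexConjugate
open Literature.MathematicalPhysics.KineticTheory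
open Literature.MathematicalPhysics.KineticTheory.HeatConduction
open HarmonicChaos
open PinnedChainKinetic (𝕋 μ𝕋 cosT dispersion)
open scoped Literature.MathematicalPhysics.KineticTheory.HeatConduction.PinnedChainKinetic

/-! ## Conjunct (a): linear observables and Wick products are local polynomials -/

/-- `φ(f) = Σ_x f^q_x q_x + Σ_x f^p_x p_x` as a finite linear combination of coordinate functions.
[folklore] -/
theorem linObs_eq_sum_smul (f : TestFn) :
    linObs f = (∑ x ∈ f.1.support, f.1 x • fun σ : ChainConfig => (σ x).1) +
      ∑ x ∈ f.2.support, f.2 x • fun σ : ChainConfig => (σ x).2 := by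
  funext σ
  simp only [linObs, Finsupp.sum, Pi.add_apply, Finset.sum_apply, Pi.smul_apply, smul_eq_mul]

/-- Linear observables are local polynomials. [folklore] -/
theorem linObs_mem_polyObs (f : TestFn) :
    linObs f ∈ Algebra.adjoin ℝ (Set.range fun xc : ℤ × Bool => fun σ : ChainConfig =>
      if xc.2 then (σ xc.1).2 else (σ xc.1).1) := by
  rw [linObs_eq_sum_smul]
  refine add_mem (Subalgebra.sum_mem _ fun x _ => Subalgebra.smul_mem _ ?_ _)
    (Subalgebra.sum_mem _ fun x _ => Subalgebra.smul_mem _ ?_ _)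
  · exact Algebra.subset_adjoin ⟨(x, false), by funext σ; simp⟩
  · exact Algebra.subset_adjoin ⟨(x, true), by funext σ; simp⟩

/-- The Wick recursion at the level of functions:
`W_{N+2}(f) = φ(f₀) W_{N+1}(tail f) − Σ_i C_T(f₀, f_{i+1}) W_N(tail f minus slot i)`. [cite: Janson1997, Thm 3.15] -/
theorem wick_succ_succ_eq (ω₂ T : ℝ) (N : ℕ) (f : Fin (N + 2) → TestFn) :
    wick ω₂ T (N + 2) f = linObs (f 0) * wick ω₂ T (N + 1) (Fin.tail f) -
      ∑ i : Fin (N + 1), thermalCov ω₂ T (f 0) (Fin.tail f i) •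
        wick ω₂ T N (Fin.removeNth i (Fin.tail f)) := by
  funext σ
  simp only [wick, Pi.sub_apply, Pi.mul_apply, Finset.sum_apply, Pi.smul_apply, smul_eq_mul]
  rfl

/-- **Conjunct (a) of stub KAlg: Wick products of linear observables are local polynomials**
(induction along Janson's recursion; closure of the subalgebra `𝒫`). [folklore] -/
theorem wick_mem_polyObs (ω₂ T : ℝ) (N : ℕ) (f : Fin N → TestFn) :
    wick ω₂ T N f ∈ Algebra.adjoin ℝ (Set.range fun xc : ℤ × Bool => fun σ : ChainConfig =>
      if xc.2 then (σ xc.1).2 else (σ xc.1).1) := by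
  induction N using Nat.twoStepInduction with
  | zero =>
    rw [wick_zero]
    exact one_mem _
  | one =>
    rw [wick_one]
    exact linObs_mem_polyObs _
  | more N ihN ihN1 =>
    rw [wick_succ_succ_eq]
    exact sub_mem (mul_mem (linObs_mem_polyObs _) (ihN1 _))
      (Subalgebra.sum_mem _ fun i _ => Subalgebra.smul_mem _ (ihN _) _)

/-! ## The Liouville operator is a derivation on local polynomials -/

section Derivation

variable (ω₂ lam β γ : ℝ)

/-- `𝒜` is additive on local polynomials. [folklore] -/
theorem liouvilleZ_add_of_mem_polyObs {u v : ChainConfig → ℝ}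
    (hu : u ∈ Algebra.adjoin ℝ (Set.range fun xc : ℤ × Bool => fun σ : ChainConfig =>
      if xc.2 then (σ xc.1).2 else (σ xc.1).1))
    (hv : v ∈ Algebra.adjoin ℝ (Set.range fun xc : ℤ × Bool => fun σ : ChainConfig =>
      if xc.2 then (σ xc.1).2 else (σ xc.1).1)) :
    liouvilleZ (pinnedChain ω₂ lam β γ) (u + v) =
      liouvilleZ (pinnedChain ω₂ lam β γ) u + liouvilleZ (pinnedChain ω₂ lam β γ) v := by
  obtain ⟨⟨R₁, h₁⟩, -⟩ := exists_rep_and_liouvilleZ_mem_of_mem_polyObs ω₂ lam β γ hu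
  obtain ⟨⟨R₂, h₂⟩, -⟩ := exists_rep_and_liouvilleZ_mem_of_mem_polyObs ω₂ lam β γ hv
  obtain ⟨g₁, hg₁, rfl⟩ := h₁ (max R₁ R₂) (le_max_left _ _)
  obtain ⟨g₂, hg₂, rfl⟩ := h₂ (max R₁ R₂) (le_max_right _ _)
  exact liouvilleZ_add_comp_boxRestrict _ _ (hg₁.differentiable one_ne_zero)
    (hg₂.differentiable one_ne_zero)

/-- **Leibniz rule**: `𝒜(uv) = u 𝒜v + v 𝒜u` on local polynomials. [folklore] -/
theorem liouvilleZ_mul_of_mem_polyObs {u v : ChainConfig → ℝ}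
    (hu : u ∈ Algebra.adjoin ℝ (Set.range fun xc : ℤ × Bool => fun σ : ChainConfig =>
      if xc.2 then (σ xc.1).2 else (σ xc.1).1))
    (hv : v ∈ Algebra.adjoin ℝ (Set.range fun xc : ℤ × Bool => fun σ : ChainConfig =>
      if xc.2 then (σ xc.1).2 else (σ xc.1).1)) :
    liouvilleZ (pinnedChain ω₂ lam β γ) (u * v) =
      u * liouvilleZ (pinnedChain ω₂ lam β γ) v + v * liouvilleZ (pinnedChain ω₂ lam β γ) u := by
  obtain ⟨⟨R₁, h₁⟩, -⟩ := exists_rep_and_liouvilleZ_mem_of_mem_polyObs ω₂ lam β γ hu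
  obtain ⟨⟨R₂, h₂⟩, -⟩ := exists_rep_and_liouvilleZ_mem_of_mem_polyObs ω₂ lam β γ hv
  obtain ⟨g₁, hg₁, rfl⟩ := h₁ (max R₁ R₂) (le_max_left _ _)
  obtain ⟨g₂, hg₂, rfl⟩ := h₂ (max R₁ R₂) (le_max_right _ _)
  exact liouvilleZ_mul_comp_boxRestrict _ _ (hg₁.differentiable one_ne_zero)
    (hg₂.differentiable one_ne_zero)

/-- `𝒜` is `ℝ`-homogeneous on local polynomials. [folklore] -/
theorem liouvilleZ_smul_of_mem_polyObs (c : ℝ) {u : ChainConfig → ℝ}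
    (hu : u ∈ Algebra.adjoin ℝ (Set.range fun xc : ℤ × Bool => fun σ : ChainConfig =>
      if xc.2 then (σ xc.1).2 else (σ xc.1).1)) :
    liouvilleZ (pinnedChain ω₂ lam β γ) (c • u) = c • liouvilleZ (pinnedChain ω₂ lam β γ) u := by
  have hc : (fun _ : ChainConfig => c) ∈ Algebra.adjoin ℝ (Set.range fun xc : ℤ × Bool =>
      fun σ : ChainConfig => if xc.2 then (σ xc.1).2 else (σ xc.1).1) :=
    Subalgebra.algebraMap_mem _ c
  have h := liouvilleZ_mul_of_mem_polyObs ω₂ lam β γ hc hu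
  rw [liouvilleZ_const, mul_zero, add_zero] at h
  have hcu : c • u = (fun _ : ChainConfig => c) * u := by
    funext σ
    simp
  rw [hcu, h]
  funext σ
  simp

/-- `𝒜(u − v) = 𝒜u − 𝒜v` on local polynomials. [folklore] -/
theorem liouvilleZ_sub_of_mem_polyObs {u v : ChainConfig → ℝ}
    (hu : u ∈ Algebra.adjoin ℝ (Set.range fun xc : ℤ × Bool => fun σ : ChainConfig =>
      if xc.2 then (σ xc.1).2 else (σ xc.1).1))
    (hv : v ∈ Algebra.adjoin ℝ (Set.range fun xc : ℤ × Bool => fun σ : ChainConfig =>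
      if xc.2 then (σ xc.1).2 else (σ xc.1).1)) :
    liouvilleZ (pinnedChain ω₂ lam β γ) (u - v) =
      liouvilleZ (pinnedChain ω₂ lam β γ) u - liouvilleZ (pinnedChain ω₂ lam β γ) v := by
  rw [sub_eq_add_neg, ← neg_one_smul ℝ v, liouvilleZ_add_of_mem_polyObs ω₂ lam β γ hu
    (Subalgebra.smul_mem _ hv _), liouvilleZ_smul_of_mem_polyObs ω₂ lam β γ _ hv, neg_one_smul,
    sub_eq_add_neg]

/-- `𝒜` commutes with finite sums of local polynomials. [folklore] -/
theorem liouvilleZ_sum_of_mem_polyObs {ι : Type*} (s : Finset ι) (u : ι → ChainConfig → ℝ)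
    (hu : ∀ i ∈ s, u i ∈ Algebra.adjoin ℝ (Set.range fun xc : ℤ × Bool => fun σ : ChainConfig =>
      if xc.2 then (σ xc.1).2 else (σ xc.1).1)) :
    liouvilleZ (pinnedChain ω₂ lam β γ) (∑ i ∈ s, u i) =
      ∑ i ∈ s, liouvilleZ (pinnedChain ω₂ lam β γ) (u i) := by
  classical
  induction s using Finset.induction_on with
  | empty =>
    simp only [Finset.sum_empty]
    exact liouvilleZ_const _ 0
  | insert a s ha ih =>
    rw [Finset.sum_insert ha, Finset.sum_insert ha,
      liouvilleZ_add_of_mem_polyObs ω₂ lam β γ (hu a (Finset.mem_insert_self a s))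
        (Subalgebra.sum_mem _ fun i hi => hu i (Finset.mem_insert_of_mem hi)),
      ih fun i hi => hu i (Finset.mem_insert_of_mem hi)]

end Derivation

/-! ## The harmonic chain: `𝓛₀ φ(f) = φ(L f)` -/

/-- The force of the harmonic chain `pinnedChain ω₂ 0 0 γ`: `F_x = −(ω₂+2) q_x + q_{x+1} + q_{x−1}`.
[folklore] -/
theorem force_harmonicChain (ω₂ γ : ℝ) (σ : ChainConfig) (x : ℤ) :
    (pinnedChain ω₂ 0 0 γ).force σ x = -(ω₂ + 2) * (σ x).1 + (σ (x + 1)).1 + (σ (x - 1)).1 := by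
  rw [OscillatorChain.force_eq, pinnedChain_deriv_U_eq, pinnedChain_deriv_V_eq]
  ring

/-- **`𝓛₀ φ(f) = φ(Lf)`**: on linear observables the harmonic Liouville operator acts through the
lattice Klein–Gordon generator `L f = (−(ω₂+2) f^p + S f^p + S⁻¹ f^p, f^q)`. [folklore] -/
theorem liouvilleZ_linObs_harmonic (ω₂ γ : ℝ) (f : TestFn) (σ : ChainConfig) :
    liouvilleZ (pinnedChain ω₂ 0 0 γ) (linObs f) σ =
      linObs ((-(ω₂ + 2)) • f.2 + Finsupp.mapDomain (fun x : ℤ => x + 1) f.2 +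
        Finsupp.mapDomain (fun x : ℤ => x - 1) f.2, f.1) σ := by
  have hq : ∀ x : ℤ, (fun σ : ChainConfig => (σ x).1) ∈ Algebra.adjoin ℝ (Set.range
      fun xc : ℤ × Bool => fun σ : ChainConfig => if xc.2 then (σ xc.1).2 else (σ xc.1).1) :=
    fun x => Algebra.subset_adjoin ⟨(x, false), by funext σ; simp⟩
  have hp : ∀ x : ℤ, (fun σ : ChainConfig => (σ x).2) ∈ Algebra.adjoin ℝ (Set.range
      fun xc : ℤ × Bool => fun σ : ChainConfig => if xc.2 then (σ xc.1).2 else (σ xc.1).1) :=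
    fun x => Algebra.subset_adjoin ⟨(x, true), by funext σ; simp⟩
  rw [linObs_eq_sum_smul, liouvilleZ_add_of_mem_polyObs ω₂ 0 0 γ
    (Subalgebra.sum_mem _ fun x _ => Subalgebra.smul_mem _ (hq x) _)
    (Subalgebra.sum_mem _ fun x _ => Subalgebra.smul_mem _ (hp x) _),
    liouvilleZ_sum_of_mem_polyObs ω₂ 0 0 γ _ _ (fun x _ => Subalgebra.smul_mem _ (hq x) _),
    liouvilleZ_sum_of_mem_polyObs ω₂ 0 0 γ _ _ (fun x _ => Subalgebra.smul_mem _ (hp x) _)]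
  simp_rw [liouvilleZ_smul_of_mem_polyObs ω₂ 0 0 γ _ (hq _),
    liouvilleZ_smul_of_mem_polyObs ω₂ 0 0 γ _ (hp _)]
  simp only [Pi.add_apply, Finset.sum_apply, Pi.smul_apply, smul_eq_mul, liouvilleZ_position,
    liouvilleZ_momentum, force_harmonicChain]
  unfold linObs
  rw [sum_kgFst ω₂ f.2 (fun x a => a * (σ x).1) (fun x => by ring) (fun x a b => by ring)]
  simp only [Finsupp.sum]
  rw [add_comm]
  congr 1
  exact Finset.sum_congr rfl fun x _ => by ring


/-! ## Conjunct (b): the Leibniz rule of `𝓛` on Wick products -/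

/-- **Leibniz rule of a Liouville operator on Wick products, abstract form.** If `𝓛 = liouvilleZ P`
(`P = pinnedChain ω₂ lam β γ`) acts on linear observables through a map `L` of coefficient data,
`𝓛 φ(g) = φ(L g)`, and the covariance `C_T` defining the Wick products is `L`-skew, then
`𝓛 :φ(f₀)⋯φ(f_{N−1}): = Σ_i :φ(f₀)⋯φ(L f_i)⋯φ(f_{N−1}):` (two-step induction along Janson's
recursion; the correction terms cancel by skewness). [folklore] -/
theorem liouvilleZ_wick_of_linear (ω₂ lam β γ T : ℝ) (L : TestFn → TestFn)
    (hL1 : ∀ (g : TestFn) (σ : ChainConfig),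
      liouvilleZ (pinnedChain ω₂ lam β γ) (linObs g) σ = linObs (L g) σ)
    (hL2 : ∀ g g' : TestFn, thermalCov ω₂ T (L g) g' = -thermalCov ω₂ T g (L g')) :
    ∀ (N : ℕ) (f : Fin N → TestFn) (σ : ChainConfig),
      liouvilleZ (pinnedChain ω₂ lam β γ) (wick ω₂ T N f) σ =
        ∑ i : Fin N, wick ω₂ T N (update f i (L (f i))) σ := by
  intro N
  induction N using Nat.twoStepInduction with
  | zero =>
    intro f σ
    rw [wick_zero, liouvilleZ_const]
    simp
  | one =>
    intro f σ
    rw [wick_one, hL1, Fin.sum_univ_one, wick_one, update_self]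
  | more N ihN ihN1 =>
    intro f σ
    have hφ : ∀ g : TestFn, linObs g ∈ Algebra.adjoin ℝ (Set.range fun xc : ℤ × Bool =>
        fun σ : ChainConfig => if xc.2 then (σ xc.1).2 else (σ xc.1).1) := linObs_mem_polyObs
    have hW : ∀ (M : ℕ) (g : Fin M → TestFn), wick ω₂ T M g ∈ Algebra.adjoin ℝ (Set.range
        fun xc : ℤ × Bool => fun σ : ChainConfig => if xc.2 then (σ xc.1).2 else (σ xc.1).1) :=
      wick_mem_polyObs ω₂ T
    have hu : linObs (f 0) * wick ω₂ T (N + 1) (Fin.tail f) ∈ Algebra.adjoin ℝ (Set.range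
        fun xc : ℤ × Bool => fun σ : ChainConfig => if xc.2 then (σ xc.1).2 else (σ xc.1).1) :=
      mul_mem (hφ _) (hW _ _)
    have hv' : ∀ i ∈ (Finset.univ : Finset (Fin (N + 1))),
        thermalCov ω₂ T (f 0) (Fin.tail f i) • wick ω₂ T N (Fin.removeNth i (Fin.tail f)) ∈
          Algebra.adjoin ℝ (Set.range fun xc : ℤ × Bool => fun σ : ChainConfig =>
            if xc.2 then (σ xc.1).2 else (σ xc.1).1) :=
      fun i _ => Subalgebra.smul_mem _ (hW _ _) _
    have hv : (∑ i : Fin (N + 1), thermalCov ω₂ T (f 0) (Fin.tail f i) •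
        wick ω₂ T N (Fin.removeNth i (Fin.tail f))) ∈ Algebra.adjoin ℝ (Set.range
          fun xc : ℤ × Bool => fun σ : ChainConfig => if xc.2 then (σ xc.1).2 else (σ xc.1).1) :=
      Subalgebra.sum_mem _ hv'
    -- the left-hand side at the level of functions: `𝓛` is a derivation
    have hL : liouvilleZ (pinnedChain ω₂ lam β γ) (wick ω₂ T (N + 2) f) =
        linObs (f 0) * liouvilleZ (pinnedChain ω₂ lam β γ) (wick ω₂ T (N + 1) (Fin.tail f)) +
          wick ω₂ T (N + 1) (Fin.tail f) * liouvilleZ (pinnedChain ω₂ lam β γ) (linObs (f 0)) -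
          ∑ i : Fin (N + 1), thermalCov ω₂ T (f 0) (Fin.tail f i) •
            liouvilleZ (pinnedChain ω₂ lam β γ) (wick ω₂ T N (Fin.removeNth i (Fin.tail f))) := by
      rw [wick_succ_succ_eq, liouvilleZ_sub_of_mem_polyObs ω₂ lam β γ hu hv,
        liouvilleZ_mul_of_mem_polyObs ω₂ lam β γ (hφ (f 0)) (hW _ (Fin.tail f)),
        liouvilleZ_sum_of_mem_polyObs ω₂ lam β γ Finset.univ
          (fun i => thermalCov ω₂ T (f 0) (Fin.tail f i) •
            wick ω₂ T N (Fin.removeNth i (Fin.tail f))) hv']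
      congr 1
      exact Finset.sum_congr rfl fun i _ => liouvilleZ_smul_of_mem_polyObs ω₂ lam β γ _ (hW _ _)
    -- … evaluated at `σ`, with the induction hypotheses and `𝓛 φ(f₀) = φ(L f₀)`
    have hLσ : liouvilleZ (pinnedChain ω₂ lam β γ) (wick ω₂ T (N + 2) f) σ =
        linObs (f 0) σ * (∑ j : Fin (N + 1),
            wick ω₂ T (N + 1) (update (Fin.tail f) j (L (Fin.tail f j))) σ) +
          wick ω₂ T (N + 1) (Fin.tail f) σ * linObs (L (f 0)) σ -
          ∑ i : Fin (N + 1), thermalCov ω₂ T (f 0) (Fin.tail f i) *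
            ∑ j : Fin N, wick ω₂ T N (update (Fin.removeNth i (Fin.tail f)) j
              (L (Fin.removeNth i (Fin.tail f) j))) σ := by
      rw [hL]
      simp only [Pi.sub_apply, Pi.add_apply, Pi.mul_apply, Finset.sum_apply, Pi.smul_apply,
        smul_eq_mul]
      rw [ihN1, hL1]
      simp_rw [ihN]
    -- the right-hand side: slot `0`
    have h0 : wick ω₂ T (N + 2) (update f 0 (L (f 0))) σ =
        linObs (L (f 0)) σ * wick ω₂ T (N + 1) (Fin.tail f) σ -
          ∑ i : Fin (N + 1), thermalCov ω₂ T (L (f 0)) (Fin.tail f i) *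
            wick ω₂ T N (Fin.removeNth i (Fin.tail f)) σ := by
      rw [wick_succ_succ_eq, Fin.tail_update_zero]
      simp only [Pi.sub_apply, Pi.mul_apply, Finset.sum_apply, Pi.smul_apply, smul_eq_mul,
        update_self]
    -- the right-hand side: slots `j + 1`
    have hj : ∀ j : Fin (N + 1), wick ω₂ T (N + 2) (update f j.succ (L (f j.succ))) σ =
        linObs (f 0) σ * wick ω₂ T (N + 1) (update (Fin.tail f) j (L (Fin.tail f j))) σ -
          ∑ i : Fin (N + 1), thermalCov ω₂ T (f 0) (update (Fin.tail f) j (L (Fin.tail f j)) i) *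
            wick ω₂ T N (Fin.removeNth i (update (Fin.tail f) j (L (Fin.tail f j)))) σ := by
      intro j
      rw [wick_succ_succ_eq, Fin.tail_update_succ]
      simp only [Pi.sub_apply, Pi.mul_apply, Finset.sum_apply, Pi.smul_apply, smul_eq_mul,
        update_of_ne (Fin.succ_ne_zero j).symm]
      rfl
    -- the double sum of correction terms, reorganised slot by slot
    have hsum : ∑ j : Fin (N + 1), ∑ i : Fin (N + 1),
        thermalCov ω₂ T (f 0) (update (Fin.tail f) j (L (Fin.tail f j)) i) *
          wick ω₂ T N (Fin.removeNth i (update (Fin.tail f) j (L (Fin.tail f j)))) σ =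
        ∑ i : Fin (N + 1), (thermalCov ω₂ T (f 0) (L (Fin.tail f i)) *
            wick ω₂ T N (Fin.removeNth i (Fin.tail f)) σ +
          thermalCov ω₂ T (f 0) (Fin.tail f i) * ∑ j : Fin N,
            wick ω₂ T N (update (Fin.removeNth i (Fin.tail f)) j
              (L (Fin.removeNth i (Fin.tail f) j))) σ) := by
      rw [Finset.sum_comm]
      refine Finset.sum_congr rfl fun i _ => ?_
      rw [Fin.sum_univ_succAbove _ i, update_self, Fin.removeNth_update, Finset.mul_sum]
      congr 1
      refine Finset.sum_congr rfl fun j _ => ?_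
      rw [update_of_ne (Fin.succAbove_ne i j).symm, Fin.removeNth_update_succAbove]
      rfl
    have hskew : ∀ i : Fin (N + 1), thermalCov ω₂ T (L (f 0)) (Fin.tail f i) =
        -thermalCov ω₂ T (f 0) (L (Fin.tail f i)) := fun i => hL2 _ _
    rw [Fin.sum_univ_succ, h0]
    simp_rw [hj]
    rw [Finset.sum_sub_distrib, hsum, Finset.sum_add_distrib, hLσ]
    simp_rw [hskew]
    simp only [neg_mul, Finset.sum_neg_distrib, Finset.mul_sum]
    ring

/-- **Conjunct (b) of stub KAlg: the Leibniz rule of `𝓛₀` on Wick products of the harmonic chain.**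
For `ω₂ > 0`, `𝓛₀ = liouvilleZ (pinnedChain ω₂ 0 0 γ)` and the lattice Klein–Gordon generator
`L f = (−(ω₂+2) f^p + S f^p + S⁻¹ f^p, f^q)`:
`𝓛₀ :φ(f₀)⋯φ(f_{N−1}): = Σ_i :φ(f₀)⋯φ(L f_i)⋯φ(f_{N−1}):` pointwise. [folklore] -/
theorem liouvilleZ_wick_harmonic {ω₂ : ℝ} (hω : 0 < ω₂) (γ T : ℝ) (N : ℕ) (f : Fin N → TestFn)
    (σ : ChainConfig) :
    liouvilleZ (pinnedChain ω₂ 0 0 γ) (wick ω₂ T N f) σ =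
      ∑ i : Fin N, wick ω₂ T N (Function.update f i ((-(ω₂ + 2)) • (f i).2 +
        Finsupp.mapDomain (fun x : ℤ => x + 1) (f i).2 +
        Finsupp.mapDomain (fun x : ℤ => x - 1) (f i).2, (f i).1)) σ :=
  liouvilleZ_wick_of_linear ω₂ 0 0 γ T (fun g => ((-(ω₂ + 2)) • g.2 +
      Finsupp.mapDomain (fun x : ℤ => x + 1) g.2 + Finsupp.mapDomain (fun x : ℤ => x - 1) g.2, g.1))
    (fun g σ => liouvilleZ_linObs_harmonic ω₂ γ g σ) (fun g g' => thermalCov_kg_skew hω T g g') N f σ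

/-! ## The registered stub -/

/-- **STUB KAlg** (M–L): Leibniz rule of `𝓛₀` on Wick products, `w_{Lf} = −iω w_f`, skewness of the thermal covariance.
(a) Wick products of linear observables are local polynomials; (b) for `ω₂ > 0`,
`𝓛₀ :φ(f₀)⋯φ(f_{N−1}): = Σ_i :⋯φ(L f_i)⋯:` pointwise with the lattice Klein–Gordon generator
`L f = (−(ω₂+2) f^p + S f^p + S⁻¹ f^p, f^q)`; (c) `w_{Lf}(k) = −iω(k) w_f(k)`; (d) `C_T(Lf, g) = −C_T(f, Lg)`.
[cite: Janson1997, Thm 3.15] -/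
theorem stub_harmonicPencilAlgebra :
  (∀ (ω₂ T : ℝ) (N : ℕ) (f : Fin N → TestFn), wick ω₂ T N f ∈ Algebra.adjoin ℝ (Set.range fun xc : ℤ × Bool => fun σ : ChainConfig => if xc.2 then (σ xc.1).2 else (σ xc.1).1)) ∧
  (∀ (ω₂ γ T : ℝ), 0 < ω₂ → ∀ (N : ℕ) (f : Fin N → TestFn) (σ : ChainConfig),
      liouvilleZ (pinnedChain ω₂ 0 0 γ) (wick ω₂ T N f) σ =
        ∑ i : Fin N, wick ω₂ T N (Function.update f i ((-(ω₂ + 2)) • (f i).2 + Finsupp.mapDomain (fun x : ℤ => x + 1) (f i).2 + Finsupp.mapDomain (fun x : ℤ => x - 1) (f i).2, (f i).1)) σ) ∧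
  (∀ (ω₂ T : ℝ), 0 < ω₂ → ∀ (f : TestFn) (k : 𝕋),
      thermalWave ω₂ T ((-(ω₂ + 2)) • f.2 + Finsupp.mapDomain (fun x : ℤ => x + 1) f.2 + Finsupp.mapDomain (fun x : ℤ => x - 1) f.2, f.1) k = -Complex.I * (PinnedChainKinetic.dispersion ω₂ k : ℂ) * thermalWave ω₂ T f k) ∧
  (∀ (ω₂ T : ℝ), 0 < ω₂ → ∀ f g : TestFn,
      thermalCov ω₂ T ((-(ω₂ + 2)) • f.2 + Finsupp.mapDomain (fun x : ℤ => x + 1) f.2 + Finsupp.mapDomain (fun x : ℤ => x - 1) f.2, f.1) g = -thermalCov ω₂ T f ((-(ω₂ + 2)) • g.2 + Finsupp.mapDomain (fun x : ℤ => x + 1) g.2 + Finsupp.mapDomain (fun x : ℤ => x - 1) g.2, g.1)) := by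
  refine ⟨fun ω₂ T N f => wick_mem_polyObs ω₂ T N f, fun ω₂ γ T hω N f σ => ?_,
    fun ω₂ T hω f k => thermalWave_kg hω T f k, fun ω₂ T hω f g => thermalCov_kg_skew hω T f g⟩
  exact liouvilleZ_wick_harmonic hω γ T N f σ

end Summit.AtomisticToContinuum.FouriersLaw.Theorems.DrudeDissolution.GramPencilHarmonicChaos

end
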